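import Mathlib
import Summits.CriticalPhenomena.CardyFormulaZ2.Theorems.CardySelfRefinementGradientComparabilityStubPivotalUniformlySmall
import Summits.CriticalPhenomena.CardyFormulaZ2.Theorems.CardySelfRefinementGradientComparabilityStubBulkPivotalSumDivergesSections
import HarnessLib

/-!
# Section influences of bulk edges are uniformly small (one open arm inside the bulk)

Crux `stmt-CriticalPhenomena-10269`
(`Summit.CriticalPhenomena.CardyFormulaZ2.Theses.CardySelfRefinement.GradientComparability`),
line **Sketch**, helper file of the stub `stub_bulkPivotalSum_diverges` (D3-bulk).  Vocabulary
(`Aloc`, `window`) from `CardySelfRefinementDefs`; sections `A^ξ = {ω | (ω ∖ L) ∪ ξ ∈ Aloc}` from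
`…StubBulkPivotalSumDivergesSections`.

## Mathematics

The conditional form of (D2) `stub_pivotal_uniformly_small`.  Fix a quad family `F`, a radius
`ρ > 0` and `ε > 0`.  For every small mesh `η`, every layer `L` with a layer configuration
`ξ ⊆ L`, and every edge `e ∉ L` which is `ρ`-far from the layer (every edge of `L` has an endpoint
at drawn distance `≥ ρ` from both endpoints of `e`), the probability that `e` is pivotal for the
section `A^ξ` is `≤ ε`.  Indeed `e` is pivotal for `A^ξ` at `ω` iff it is pivotal for `Aloc` at
`ω' = (ω ∖ L) ∪ ξ` (`isPivotal_section_iff`); then closing `e` destroys the crossing of some quad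
`F i` by `ω' ∩ W`, which leaves one open arm of `(ω' ∖ {e}) ∩ W` around `e` from distance `≍ δ`
(`δ = η√2`) to distance `R' − δ`, `R' = min(dist(∂₀F i, ∂₂F i)/3, ρ/4)`
(`annulusOpenCrossing_of_crossing_destroyed`).  This arm event is increasing and determined by the
edges with both endpoints within `R' + δ < ρ` of the drawn endpoint of `e`, none of which lies in
`L`; so it is realised by `ω` itself, and its `P_{1/2}`-probability is `≤ (c₁δ/(R' − δ))^α → 0` by the
RSW annulus bound `annulusOpenCrossing_half_le_holds`, uniformly in the centre, in `L` and in `ξ`.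
-/

noncomputable section

namespace Summit.CriticalPhenomena.CardyFormulaZ2.Theorems.CardySelfRefinement

open scoped Topology
open Filter Set MeasureTheory
open Literature.Probability.LatticeModels Literature.Probability.Percolation
open Literature.Probability.Percolation.QuadCrossing
open Summit.CriticalPhenomena.CardyFormulaZ2.Theses.CardySelfRefinement

/-- The drawn position of a site at mesh `η` is the mesh point of `δℤ²`, `δ = η√2`. -/
theorem eta_mul_z_eq_meshPoint (η : ℝ) (x : Site 2) :
    (η : ℂ) * squareLatticeEmbedding.z x = meshPoint (η * Real.sqrt 2) x := by
  simp only [squareLatticeEmbedding, meshPoint, Complex.ofReal_mul, mul_assoc]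

/-- An increasing event determined by `D` which holds at `ω₂` holds at every configuration
containing `ω₂ ∩ D`. -/
theorem mem_of_isUpperSet_of_determinedBy {V : Type*} {E : Set (BondConfig V)} (hE : IsUpperSet E)
    {D : Set (Sym2 V)} (hdet : DeterminedBy E D) {ω₂ ω : BondConfig V} (h₂ : ω₂ ∈ E)
    (hsub : ω₂ ∩ D ⊆ ω) : ω ∈ E := by
  have h : ω₂ ∩ D ∈ E :=
    ((determinedBy_iff _ _).1 hdet ω₂ (ω₂ ∩ D) (by rw [Set.inter_assoc, Set.inter_self])).1 h₂
  exact hE hsub h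

/-- **One quad, one edge, one layer configuration.**  For a quad `Q`, `ρ > 0` and `ε > 0`: for
all small meshes `η > 0`, every set `W` of lattice edges, every layer `L ⊇ ξ`, and every pair of
sites `u, v` such that every edge of `L` has an endpoint at drawn distance `≥ ρ` from `u`, the
`P_{1/2}`-probability that `Q` is crossed by `(ω' ∪ {uv}) ∩ W` but not by `(ω' ∖ {uv}) ∩ W`,
`ω' = (ω ∖ L) ∪ ξ`, is at most `ε`. -/
theorem eventually_real_section_crossing_destroyed_le (Q : Quad (Set.univ : Set ℂ)) {ρ ε : ℝ}
    (hρ : 0 < ρ) (hε : 0 < ε) :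
    ∀ᶠ η : ℝ in 𝓝[>] (0 : ℝ), ∀ W : Set (Sym2 (Site 2)), W ⊆ (zdGraph 2).edgeSet →
      ∀ L ξ : Set (Sym2 (Site 2)), ξ ⊆ L → ∀ u v : Site 2,
        (∀ f ∈ L, ∃ y ∈ f, ρ ≤ dist ((η : ℂ) * squareLatticeEmbedding.z u)
          ((η : ℂ) * squareLatticeEmbedding.z y)) →
        (bondPercolation (zdGraph 2) half).real
          {ω | Q ∈ configOf squareLatticeEmbedding.z η Set.univ (insert s(u, v) (ω \ L ∪ ξ) ∩ W) ∧
            Q ∉ configOf squareLatticeEmbedding.z η Set.univ ((ω \ L ∪ ξ) \ {s(u, v)} ∩ W)} ≤ ε := by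
  obtain ⟨α, c₀, hα, hc₀, hbound⟩ := annulusOpenCrossing_half_le_holds
  obtain ⟨d, hd, hdist⟩ := Q.exists_pos_le_dist_side_side_add_two 0
  set c₁ : ℝ := max 3 c₀ with hc₁
  set R' : ℝ := min (d / 3) (ρ / 4) with hR'
  have hR'pos : 0 < R' := by positivity
  have hR'ρ : R' ≤ ρ / 4 := min_le_right _ _
  have hc₁3 : (3 : ℝ) ≤ c₁ := le_max_left _ _
  have hc₀c₁ : c₀ ≤ c₁ := le_max_right _ _
  have hsides : ∀ z₀ ∈ Q.side 0, ∀ z₂ ∈ Q.side 2, 2 * R' < dist z₀ z₂ := fun z₀ h₀ z₂ h₂ => by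
    have h := hdist z₀ h₀ z₂ h₂
    have h' : R' ≤ d / 3 := min_le_left _ _
    linarith
  have h0 : ∀ᶠ η in 𝓝[>] (0 : ℝ), 0 < η := eventually_mem_nhdsWithin
  have h1 : ∀ᶠ η in 𝓝[>] (0 : ℝ), (2 * c₁ + 1) * (η * Real.sqrt 2) ≤ R' := by
    have ht : Tendsto (fun η : ℝ => (2 * c₁ + 1) * (η * Real.sqrt 2)) (𝓝 0) (𝓝 0) := by
      have hc : Continuous fun η : ℝ => (2 * c₁ + 1) * (η * Real.sqrt 2) :=
        continuous_const.mul (continuous_id.mul continuous_const)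
      simpa using hc.tendsto 0
    exact (ht.eventually_le_const hR'pos).filter_mono nhdsWithin_le_nhds
  have h2 : ∀ᶠ η in 𝓝[>] (0 : ℝ),
      (c₁ * (η * Real.sqrt 2) / (R' - η * Real.sqrt 2)) ^ α ≤ ε := by
    have ht : Tendsto (fun η : ℝ => c₁ * (η * Real.sqrt 2) / (R' - η * Real.sqrt 2))
        (𝓝 0) (𝓝 0) := by
      have hc : ContinuousAt
          (fun η : ℝ => c₁ * (η * Real.sqrt 2) / (R' - η * Real.sqrt 2)) 0 :=
        (continuous_const.mul (continuous_id.mul continuous_const)).continuousAt.div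
          (continuous_const.sub (continuous_id.mul continuous_const)).continuousAt
          (by simpa using hR'pos.ne')
      simpa using hc.tendsto
    exact ((ht.rpow_const_nhds_zero hα).eventually_le_const hε).filter_mono nhdsWithin_le_nhds
  filter_upwards [h0, h1, h2] with η hη0 hη1 hη2 W hW L ξ hξL u v hfar
  set δ : ℝ := η * Real.sqrt 2 with hδdef
  have hδ : 0 < δ := by positivity
  have hδR : δ ≤ ρ / 4 := by nlinarith
  by_cases he : s(u, v) ∈ W
  · have huv : (zdGraph 2).Adj u v := (SimpleGraph.mem_edgeSet _).1 (hW he)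
    calc (bondPercolation (zdGraph 2) half).real
          {ω | Q ∈ configOf squareLatticeEmbedding.z η Set.univ
              (insert s(u, v) (ω \ L ∪ ξ) ∩ W) ∧
            Q ∉ configOf squareLatticeEmbedding.z η Set.univ ((ω \ L ∪ ξ) \ {s(u, v)} ∩ W)}
        ≤ (bondPercolation (zdGraph 2) half).real
            (annulusOpenCrossing (meshPoint δ u) δ (c₁ * δ) (R' - δ)) := by
          refine measureReal_mono (fun ω hω => ?_)
          obtain ⟨hin, hout⟩ := hω
          have hW₁ : insert s(u, v) (ω \ L ∪ ξ) ∩ W ⊆ (zdGraph 2).edgeSet :=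
            Set.inter_subset_right.trans hW
          have hW₂ : (ω \ L ∪ ξ) \ {s(u, v)} ∩ W ⊆ (zdGraph 2).edgeSet :=
            Set.inter_subset_right.trans hW
          rw [mem_configOf_iff_exists_isCrossing_openEdgeUnion hη0 hW₁] at hin
          rw [mem_configOf_iff_exists_isCrossing_openEdgeUnion hη0 hW₂] at hout
          have h₁₂ : insert s(u, v) (ω \ L ∪ ξ) ∩ W ⊆
              insert s(u, v) ((ω \ L ∪ ξ) \ {s(u, v)} ∩ W) := by
            rintro f ⟨hf, hfW⟩
            by_cases hfe : f = s(u, v)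
            · exact hfe ▸ Set.mem_insert _ _
            · rcases Set.mem_insert_iff.1 hf with hfe' | hfω
              · exact absurd hfe' hfe
              · exact Set.mem_insert_of_mem _ ⟨⟨hfω, hfe⟩, hfW⟩
          have hmem := annulusOpenCrossing_of_crossing_destroyed Q hδ hc₁3 (by nlinarith) hsides
            huv h₁₂ hin hout
          -- the arm is realised by `ω` itself: no edge of `ξ ⊆ L` is read by the arm event
          refine mem_of_isUpperSet_of_determinedBy (isUpperSet_annulusOpenCrossing _ _ _ _)
            (determinedBy_annulusOpenCrossing hδ (meshPoint δ u) (c₁ * δ) (R' - δ)) hmem ?_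
          rintro g ⟨⟨⟨hg, -⟩, -⟩, hgD⟩
          rcases hg with hg | hg
          · exact hg.1
          · exfalso
            obtain ⟨y, hyg, hy⟩ := hfar g (hξL hg)
            have hyD := (Finset.mem_sym2_iff.1 (Finset.mem_coe.1 hgD)) y hyg
            rw [Set.Finite.mem_toFinset, Set.mem_setOf_eq] at hyD
            rw [eta_mul_z_eq_meshPoint, eta_mul_z_eq_meshPoint, dist_comm] at hy
            have : R' - δ + 2 * δ = R' + δ := by ring
            rw [this] at hyD
            linarith
      _ ≤ (c₁ * δ / (R' - δ)) ^ α :=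
          hbound _ δ (c₁ * δ) (R' - δ) hδ (by nlinarith) (by nlinarith)
      _ ≤ ε := hη2
  · -- an edge outside `W` changes nothing
    have hempty : {ω : BondConfig (Site 2) |
        Q ∈ configOf squareLatticeEmbedding.z η Set.univ (insert s(u, v) (ω \ L ∪ ξ) ∩ W) ∧
          Q ∉ configOf squareLatticeEmbedding.z η Set.univ
            ((ω \ L ∪ ξ) \ {s(u, v)} ∩ W)} = ∅ := by
      ext ω
      simp only [Set.mem_setOf_eq, Set.mem_empty_iff_false, iff_false, not_and, not_not]
      rw [Set.insert_inter_of_notMem he, Set.sdiff_inter_right_comm,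
        Set.sdiff_singleton_eq_self (fun h => he h.2)]
      exact id
    rw [hempty, measureReal_empty]
    exact hε.le

/-- **Section influences of far bulk edges are uniformly small** (registered sub-goal).  For a
nonempty quad family, `ρ > 0` and `ε > 0` there is `ηs > 0` such that for every mesh
`η ∈ (0, ηs)`, every layer `L` with a layer configuration `ξ ⊆ L`, and every edge `e ∉ L` such
that every edge of `L` has an endpoint at drawn distance `≥ ρ` from both endpoints of `e`, the
`P_{1/2}`-probability that `e` is pivotal for the section `{ω | (ω ∖ L) ∪ ξ ∈ Aloc m F η}` is
`≤ ε`. -/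
theorem section_pivotal_uniformly_small :
    ∀ (m : ℕ) (F : Fin m → Quad (Set.univ : Set ℂ)), 0 < m → ∀ ρ : ℝ, 0 < ρ → ∀ ε : ℝ, 0 < ε →
      ∃ ηs : ℝ, 0 < ηs ∧ ∀ η ∈ Set.Ioo 0 ηs, ∀ L ξ : Finset (Sym2 (Site 2)), ξ ⊆ L →
        ∀ e : Sym2 (Site 2), e ∉ L →
          (∀ f ∈ L, ∃ y ∈ f, ∀ x ∈ e, ρ ≤ dist ((η : ℂ) * squareLatticeEmbedding.z x)
            ((η : ℂ) * squareLatticeEmbedding.z y)) →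
          (bondPercolation (zdGraph 2) half).real
            {ω | IsPivotal {ω' : BondConfig (Site 2) | ω' \ ↑L ∪ ↑ξ ∈ Aloc m F η} e ω} ≤ ε := by
  intro m F hm ρ hρ ε hε
  have hmpos : (0 : ℝ) < m := by exact_mod_cast hm
  have hev : ∀ᶠ η : ℝ in 𝓝[>] (0 : ℝ), ∀ L ξ : Finset (Sym2 (Site 2)), ξ ⊆ L →
      ∀ e : Sym2 (Site 2), e ∉ L →
        (∀ f ∈ L, ∃ y ∈ f, ∀ x ∈ e, ρ ≤ dist ((η : ℂ) * squareLatticeEmbedding.z x)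
          ((η : ℂ) * squareLatticeEmbedding.z y)) →
        (bondPercolation (zdGraph 2) half).real
          {ω | IsPivotal {ω' : BondConfig (Site 2) | ω' \ ↑L ∪ ↑ξ ∈ Aloc m F η} e ω} ≤ ε := by
    have hall := Filter.eventually_all.2 fun i : Fin m =>
      eventually_real_section_crossing_destroyed_le (F i) hρ (div_pos hε hmpos)
    filter_upwards [hall] with η hη L ξ hξL e heL hfar
    have hW : window m F η ⊆ (zdGraph 2).edgeSet :=
      Set.iUnion_subset fun i => Set.inter_subset_right
    induction e using Sym2.ind with
    | h u v =>
    have hfar' : ∀ f ∈ (↑L : Set (Sym2 (Site 2))), ∃ y ∈ f,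
        ρ ≤ dist ((η : ℂ) * squareLatticeEmbedding.z u) ((η : ℂ) * squareLatticeEmbedding.z y) :=
      fun f hf => by
        obtain ⟨y, hy, h⟩ := hfar f (Finset.mem_coe.1 hf)
        exact ⟨y, hy, h u (Sym2.mem_mk_left u v)⟩
    calc (bondPercolation (zdGraph 2) half).real
          {ω | IsPivotal {ω' : BondConfig (Site 2) | ω' \ ↑L ∪ ↑ξ ∈ Aloc m F η} s(u, v) ω}
        ≤ (bondPercolation (zdGraph 2) half).real (⋃ i : Fin m,
            {ω | F i ∈ configOf squareLatticeEmbedding.z η Set.univ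
                (insert s(u, v) (ω \ ↑L ∪ ↑ξ) ∩ window m F η) ∧
              F i ∉ configOf squareLatticeEmbedding.z η Set.univ
                ((ω \ ↑L ∪ ↑ξ) \ {s(u, v)} ∩ window m F η)}) := by
          refine measureReal_mono (fun ω hω => ?_)
          have hω' : IsPivotal (Aloc m F η) s(u, v) (ω \ ↑L ∪ ↑ξ) :=
            (isPivotal_section_iff m F η hξL heL ω).1 hω
          have h1 : insert s(u, v) (ω \ ↑L ∪ ↑ξ) ∈ Aloc m F η ∧
              (ω \ ↑L ∪ ↑ξ) \ {s(u, v)} ∉ Aloc m F η := by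
            rcases hω' with ⟨ha, hb⟩ | ⟨ha, hb⟩
            · exact ⟨ha, hb⟩
            · exact absurd (isUpperSet_Aloc m F η
                (Set.sdiff_subset.trans (Set.subset_insert _ _)) ha) hb
          obtain ⟨hin, hout⟩ := h1
          have hin' : ∀ i, F i ∈ configOf squareLatticeEmbedding.z η Set.univ
              (insert s(u, v) (ω \ ↑L ∪ ↑ξ) ∩ window m F η) := hin
          have hout' : ¬ ∀ i, F i ∈ configOf squareLatticeEmbedding.z η Set.univ
              ((ω \ ↑L ∪ ↑ξ) \ {s(u, v)} ∩ window m F η) := hout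
          obtain ⟨i, hi⟩ := not_forall.1 hout'
          exact Set.mem_iUnion.2 ⟨i, hin' i, hi⟩
      _ ≤ ∑ i : Fin m, (bondPercolation (zdGraph 2) half).real
            {ω | F i ∈ configOf squareLatticeEmbedding.z η Set.univ
                (insert s(u, v) (ω \ ↑L ∪ ↑ξ) ∩ window m F η) ∧
              F i ∉ configOf squareLatticeEmbedding.z η Set.univ
                ((ω \ ↑L ∪ ↑ξ) \ {s(u, v)} ∩ window m F η)} :=
          measureReal_iUnion_fintype_le _
      _ ≤ ∑ _i : Fin m, ε / m :=
          Finset.sum_le_sum fun i _ => hη i _ hW ↑L ↑ξ (Finset.coe_subset.2 hξL) u v hfar'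
      _ = ε := by
          rw [Finset.sum_const, Finset.card_univ, Fintype.card_fin, nsmul_eq_mul]
          field_simp
  obtain ⟨ηs, hηs, h⟩ := (nhdsGT_basis (0 : ℝ)).eventually_iff.1 hev
  exact ⟨ηs, hηs, fun η hη => h hη⟩

end Summit.CriticalPhenomena.CardyFormulaZ2.Theorems.CardySelfRefinement

end
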